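import Mathlib.Analysis.Normed.Module.Basic
import Mathlib.Analysis.Convex.Basic
import Mathlib.Topology.MetricSpace.Basic
import Mathlib.Topology.Algebra.Module.Basic
import HarnessLib

/-!
# Filling a ball from its boundary sphere through a chart ("coning in coordinates"), with parameters

Topic `Literature/AlgebraicTopology/Homotopy`. The elementary extension device behind "manifolds
are locally contractible, so maps of small spheres bound small balls" (Hatcher, *Algebraic
Topology* (2002), proof of Thm. A.7, p. 527: "extend over cells by induction, using local
contractibility"; Milnor 1959, proof of Lemma 4, p. 279: `q(x) = λ(w, q(y), t)` cell by cell):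
given boundary data `g a : ∂Dᵐ → Y` depending on a parameter `a`, a "chart" `φ : Y → E` into
a real normed space with a one-sided inverse `ψ : E → Y`, and centres `c a ∈ E`, the map

  `coneFill φ ψ c g a w = ψ (c a)` for `‖w‖ ≤ ½`,
  `coneFill φ ψ c g a w = ψ (c a + (2‖w‖ - 1) • (φ (g a (w/‖w‖)) - c a))` for `‖w‖ ≥ ½`

extends `g a` over the closed unit ball `Dᵐ` of `Fin m → ℝ` (sup norm, Mathlib's cell model)
whenever `ψ ∘ φ = id` at the boundary values, is jointly continuous in `(a, w)` where the data
are (no singularity at the centre: the inner half-ball is sent to the centre value), and takes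
values in `ψ` of the segments from `c a` to the `φ`-images of the boundary values — so inside
`ψ (W)` for any convex `W` containing them. Everything is PROVED; [folklore].

* `Literature.AlgebraicTopology.Homotopy.coneFill`, `coneFill_of_norm_eq_one` (it extends `g`),
  `coneFill_mem_image_segment` (image control), `continuousOn_coneFill` (joint continuity on
  `S ×ˢ closedBall 0 1` from continuity of the data on `S ×ˢ sphere 0 1`).

## References

* A. Hatcher, *Algebraic Topology*, CUP (2002), Appendix, proof of Thm. A.7 (p. 527).
  [HatcherAT2002]
* J. Milnor, *On spaces having the homotopy type of a CW-complex*, Trans. AMS 90 (1959),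
  proof of Lemma 4 (p. 279). [Milnor1959]
-/

noncomputable section

open Set Metric Function

namespace Literature.AlgebraicTopology.Homotopy

variable {A : Type*} {Y : Type*} {E : Type*} [NormedAddCommGroup E] [NormedSpace ℝ E] {m : ℕ}

/-- **Cone filling through a chart**: the inner half-ball goes to the centre value `ψ (c a)`,
the shell `½ ≤ ‖w‖ ≤ 1` interpolates linearly in `E` between the centre `c a` and the
`φ`-image of the boundary value in the direction of `w`. [folklore] -/
def coneFill (φ : Y → E) (ψ : E → Y) (c : A → E) (g : A → (Fin m → ℝ) → Y) (a : A)
    (w : Fin m → ℝ) : Y :=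
  if ‖w‖ ≤ 1 / 2 then ψ (c a) else ψ (c a + (2 * ‖w‖ - 1) • (φ (g a (‖w‖⁻¹ • w)) - c a))

variable (φ : Y → E) (ψ : E → Y) (c : A → E) (g : A → (Fin m → ℝ) → Y)

/-- On the inner half-ball the filling is the centre value. [folklore] -/
theorem coneFill_of_norm_le (a : A) {w : Fin m → ℝ} (hw : ‖w‖ ≤ 1 / 2) :
    coneFill φ ψ c g a w = ψ (c a) := by
  rw [coneFill, if_pos hw]

/-- On the outer shell the filling is the linear interpolation. [folklore] -/
theorem coneFill_of_le_norm (a : A) {w : Fin m → ℝ} (hw : 1 / 2 ≤ ‖w‖) :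
    coneFill φ ψ c g a w = ψ (c a + (2 * ‖w‖ - 1) • (φ (g a (‖w‖⁻¹ • w)) - c a)) := by
  rcases hw.lt_or_eq with h | h
  · rw [coneFill, if_neg (not_le.2 h)]
  · rw [coneFill, if_pos h.symm.le, ← h]
    norm_num

/-- **The filling extends the boundary data**: on the unit sphere, `coneFill = g` as soon as
`ψ (φ y) = y` at the boundary value `y = g a w`. [folklore] -/
theorem coneFill_of_norm_eq_one (a : A) {w : Fin m → ℝ} (hw : ‖w‖ = 1)
    (hψφ : ψ (φ (g a w)) = g a w) : coneFill φ ψ c g a w = g a w := by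
  rw [coneFill_of_le_norm φ ψ c g a (by rw [hw]; norm_num), hw]
  norm_num
  exact hψφ

/-- **Image control**: on the closed unit ball, the filling lies in `ψ` of the segment from the
centre `c a` to the `φ`-image of a boundary value (the one in the direction of `w`; for
`‖w‖ ≤ ½` it is `ψ (c a)` itself). Hence it lies in `ψ (W)` for every convex `W ∋ c a`
containing `φ (g a (sphere))`. [folklore] -/
theorem coneFill_mem_image_segment (a : A) {w : Fin m → ℝ} (hw : ‖w‖ ≤ 1) :
    coneFill φ ψ c g a w ∈ ψ '' segment ℝ (c a) (φ (g a (‖w‖⁻¹ • w))) := by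
  by_cases h : ‖w‖ ≤ 1 / 2
  · rw [coneFill_of_norm_le φ ψ c g a h]
    exact ⟨c a, left_mem_segment _ _ _, rfl⟩
  · rw [coneFill_of_le_norm φ ψ c g a (not_le.1 h).le]
    refine ⟨_, ?_, rfl⟩
    rw [segment_eq_image']
    exact ⟨2 * ‖w‖ - 1, ⟨by linarith [not_le.1 h], by linarith⟩, rfl⟩

/-- The filling lies in `ψ '' W` for a convex `W` containing the centre and the `φ`-images of the
boundary values — on the whole closed unit ball, with no condition at the centre (there the
value is `ψ (c a)`). [folklore] -/
theorem coneFill_mem_image_of_convex (a : A) {W : Set E} (hW : Convex ℝ W) (hc : c a ∈ W)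
    (hg : ∀ v ∈ sphere (0 : Fin m → ℝ) 1, φ (g a v) ∈ W) {w : Fin m → ℝ} (hw : ‖w‖ ≤ 1) :
    coneFill φ ψ c g a w ∈ ψ '' W := by
  by_cases h : ‖w‖ ≤ 1 / 2
  · rw [coneFill_of_norm_le φ ψ c g a h]
    exact ⟨c a, hc, rfl⟩
  · obtain ⟨e, he, hew⟩ := coneFill_mem_image_segment φ ψ c g a hw
    refine ⟨e, ?_, hew⟩
    have hne : w ≠ 0 := by
      rintro rfl
      exact h (by rw [norm_zero]; norm_num)
    have hdir : φ (g a (‖w‖⁻¹ • w)) ∈ W := by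
      apply hg
      rw [mem_sphere_zero_iff_norm, norm_smul, norm_inv, norm_norm,
        inv_mul_cancel₀ (norm_ne_zero_iff.2 hne)]
    exact hW.segment_subset hc hdir he

/-- **Joint continuity of the filling.** If the centres `c` are continuous on `S`, the boundary
data `(a, v) ↦ g a v` are continuous on `S ×ˢ sphere 0 1` with values where `φ` is continuous
(`φ` continuous on `V ∋ g a v`), and `ψ` is continuous on a set `T` containing all the
interpolation points `c a + s • (φ (g a v) - c a)`, `s ∈ [0, 1]`, then
`(a, w) ↦ coneFill φ ψ c g a w` is continuous on `S ×ˢ closedBall 0 1`. [folklore] -/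
theorem continuousOn_coneFill [TopologicalSpace A] [TopologicalSpace Y] {S : Set A} {V : Set Y} {T : Set E} (hc : ContinuousOn c S)
    (hg : ContinuousOn (fun p : A × (Fin m → ℝ) => g p.1 p.2) (S ×ˢ sphere 0 1))
    (hgV : ∀ a ∈ S, ∀ v ∈ sphere (0 : Fin m → ℝ) 1, g a v ∈ V) (hφ : ContinuousOn φ V)
    (hψ : ContinuousOn ψ T) (hcT : ∀ a ∈ S, c a ∈ T)
    (hT : ∀ a ∈ S, ∀ v ∈ sphere (0 : Fin m → ℝ) 1, ∀ s ∈ Icc (0 : ℝ) 1,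
      c a + s • (φ (g a v) - c a) ∈ T) :
    ContinuousOn (fun p : A × (Fin m → ℝ) => coneFill φ ψ c g p.1 p.2) (S ×ˢ closedBall 0 1) := by
  -- split the ball at radius `½`
  have hdir : ContinuousOn (fun p : A × (Fin m → ℝ) => ‖p.2‖⁻¹ • p.2)
      {p : A × (Fin m → ℝ) | 1 / 2 ≤ ‖p.2‖} := by
    refine ContinuousOn.smul (ContinuousOn.inv₀ (continuous_norm.comp continuous_snd).continuousOn
      fun p hp => ?_) continuous_snd.continuousOn
    have : (1 : ℝ) / 2 ≤ ‖p.2‖ := hp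
    exact (lt_of_lt_of_le (by norm_num) this).ne'
  have hdir_mem : ∀ p : A × (Fin m → ℝ), 1 / 2 ≤ ‖p.2‖ → ‖p.2‖⁻¹ • p.2 ∈ sphere (0 : Fin m → ℝ) 1 := by
    intro p hp
    have hne : ‖p.2‖ ≠ 0 := (lt_of_lt_of_le (by norm_num) hp).ne'
    rw [mem_sphere_zero_iff_norm, norm_smul, norm_inv, norm_norm, inv_mul_cancel₀ hne]
  -- the outer branch is continuous on `S × {½ ≤ ‖w‖ ≤ 1}`
  have hout : ContinuousOn (fun p : A × (Fin m → ℝ) =>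
      ψ (c p.1 + (2 * ‖p.2‖ - 1) • (φ (g p.1 (‖p.2‖⁻¹ • p.2)) - c p.1)))
      ((S ×ˢ closedBall 0 1) ∩ {p | 1 / 2 ≤ ‖p.2‖}) := by
    have hcS : ContinuousOn (fun p : A × (Fin m → ℝ) => c p.1) ((S ×ˢ closedBall 0 1) ∩ {p | 1 / 2 ≤ ‖p.2‖}) :=
      hc.comp continuous_fst.continuousOn fun p hp => hp.1.1
    have hgd : ContinuousOn (fun p : A × (Fin m → ℝ) => g p.1 (‖p.2‖⁻¹ • p.2))
        ((S ×ˢ closedBall 0 1) ∩ {p | 1 / 2 ≤ ‖p.2‖}) := by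
      refine hg.comp (continuous_fst.continuousOn.prodMk (hdir.mono fun p hp => hp.2)) ?_
      exact fun p hp => ⟨hp.1.1, hdir_mem p hp.2⟩
    have hφg : ContinuousOn (fun p : A × (Fin m → ℝ) => φ (g p.1 (‖p.2‖⁻¹ • p.2)))
        ((S ×ˢ closedBall 0 1) ∩ {p | 1 / 2 ≤ ‖p.2‖}) :=
      hφ.comp hgd fun p hp => hgV p.1 hp.1.1 _ (hdir_mem p hp.2)
    refine hψ.comp (hcS.add (ContinuousOn.smul ?_ (hφg.sub hcS))) fun p hp => ?_
    · exact ((continuous_const.mul (continuous_norm.comp continuous_snd)).sub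
        continuous_const).continuousOn
    · have h1 : (1 : ℝ) / 2 ≤ ‖p.2‖ := hp.2
      have h2 : ‖p.2‖ ≤ 1 := mem_closedBall_zero_iff.1 hp.1.2
      exact hT p.1 hp.1.1 _ (hdir_mem p hp.2) _ ⟨by linarith, by linarith⟩
  have hin : ContinuousOn (fun p : A × (Fin m → ℝ) => ψ (c p.1))
      ((S ×ˢ closedBall 0 1) ∩ {p | ‖p.2‖ ≤ 1 / 2}) :=
    (hψ.comp hc hcT).comp continuous_fst.continuousOn fun p hp => hp.1.1
  -- glue the two branches along `‖w‖ = ½`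
  refine ContinuousOn.if ?_ ?_ ?_
  · rintro ⟨a, w⟩ ⟨hS, hfr⟩
    have hw : ‖w‖ = 1 / 2 := by
      have := frontier_le_subset_eq (continuous_norm.comp continuous_snd) continuous_const hfr
      simpa using this
    simp only
    rw [hw]
    norm_num
  · refine hin.mono (inter_subset_inter_right _ ?_)
    exact (isClosed_le (continuous_norm.comp continuous_snd) continuous_const).closure_subset
  · refine hout.mono (inter_subset_inter_right _ ?_)
    have h1 : {p : A × (Fin m → ℝ) | ¬‖p.2‖ ≤ 1 / 2} = {p | 1 / 2 < ‖p.2‖} := by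
      ext p; simp [not_le]
    rw [h1]
    exact closure_minimal (fun p (hp : 1 / 2 < ‖p.2‖) => hp.le)
      (isClosed_le continuous_const (continuous_norm.comp continuous_snd))

end Literature.AlgebraicTopology.Homotopy

end
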